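import Summits.ResolutionOfSingularities.ResolutionOfSingularities.Theorems.EquisingularLiftEquisingularLiftNatSubchainSupplierInvSDefs
import HarnessLib

/-!
# [OURS · L1 W4.5(b) · EL♮(3) · T23-A‴ (U6)] THE INNER-CHAIN INVARIANT WITH THE PLANE TRACE AND A LIST OF MODEL-CARRYING LETTERS (definitions)
# `TCPlus.MemberSAt` (explicit-stage body of `TCPlus.MemberS`), `TCPlus.LetterDatum`, `TCPlus.MemberSL`, `TCPlus.InvSL`
# (res-L1-w45b-stub-4 T23-A‴ ENGINE WORD v1.1 FINAL f996922ad41a17f2 §0 (F4)/(U6), rule (D‴5′); KCL arm)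

res-type-027 g18 ((U6) owner; TAKING 2026-08-28T10:5xZ). Crux `EquisingularLiftNatThree` = stmt-ResolutionOfSingularities-20148 (parent stmt-…-20038), route
`EquisingularLift`, line `sections`. OURS; NOT a statement of any manuscript ([Hironaka2017] is a candidate under adjudication, nothing of it is asserted);
AI-written, weaker than expert review. Definitions + pure-logic projections only (no `sorry`, no instance, no notation; standard axioms).
`--supports stmt-ResolutionOfSingularities-20148 --as helper`.

WHAT. In tier T4 the in-carrier chain carries, besides the carrier plane `S_d` (…NatSubchainSupplierInvSDefs p617224: clauses (ix)/(x) on the carrier `𝓢`),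
a LIST `Ls` of further MODEL-CARRYING closed sets («letters»: strict transforms of hypersurfaces through the seed point) — each with its own model in the
SAME upstairs stage: `TCPlus.LetterDatum X σ jG L` := an ideal sheaf `𝓛` with reduced trace `𝓘⟨closure L⟩`, stalkwise principal, `V(𝓛)` regular, off the
generic point of `Y`, `O`-flat (= `Tower.Exc₄`'s clauses (e-i)–(e-iv) + the engine's datum `FE`, shadow forgotten, at stage level). Because `MemberS` hides its
stage behind `∃`, the stage is made EXPLICIT once (`TCPlus.MemberSAt`, `memberS_iff` by `Iff.rfl`) and `TCPlus.MemberSL … Ls …` := `∃ stage, MemberSAt ∧ ∀ L ∈ Ls,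
LetterDatum`; `TCPlus.InvSL` = `InvS` with `MemberSL`. Rule (D‴5′) of the engine word governs the steps (away: model kept, `𝓛 ↦ 𝓛·𝒪_{X₂}`; through the
point with `Z ⊄ L`: the letter leaves `Ls` for the model-less list, downstairs only). Projections: `memberSL_memberS`, `memberSL_nil_of_memberS`,
`memberSL_of_sublist`, `memberSL_letters`, `invSL_invS`, `invSL_of_sublist`.
-/

set_option linter.dupNamespace false -- mandated namespace `Summit.<Summit>.<Problem>` of this single-conjunct summit
set_option linter.overlappingInstances false -- signatures carry `[IsDomain O] [IsDiscreteValuationRing O]`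

noncomputable section

open CategoryTheory CategoryTheory.Limits AlgebraicGeometry TopologicalSpace Topology IsLocalRing
open Literature.AlgebraicGeometry.Resolution
open AlgebraicGeometry.Scheme.IdealSheafData

namespace Summit.ResolutionOfSingularities.ResolutionOfSingularities.Cruxes.EquisingularLiftNat.Sections.TCPlus

variable (O : Type) [CommRing O] [IsDomain O] [IsDiscreteValuationRing O] (k : Type) [Field k] (θ : O →+* k)
  (P : Scheme.{0}) (q : P ⟶ Spec (.of O)) (Y : Set P) (Ch : ∀ X' : Scheme.{0}, (X' ⟶ P) → Set X' → Prop)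

/-- **`TCPlus.MemberSAt` — the body of `TCPlus.MemberS` at an EXPLICIT upstairs stage `(X, σ, S, jG, tG, 𝓢, K)`** (clauses (i)–(x) verbatim).
[OURS · L1 W4.5b · T23-A‴ (U6)] -/
def MemberSAt (G : Scheme.{0}) (T Z Kd Sd : Set G) (excl : Set G) (X : Scheme.{0}) (σ : X ⟶ P) (S : Set X) (jG : G ⟶ X)
    (tG : G ⟶ Spec (.of k)) (𝓢 K : X.IdealSheafData) : Prop :=
    Ch X σ S ∧ IsIntegral X ∧ IsLocallyNoetherian X ∧ Scheme.IsRegular X ∧ IsDominant (σ ≫ q) ∧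
    IsPullback jG tG (σ ≫ q) (Spec.map (CommRingCat.ofHom θ)) ∧ jG '' T = S ∧
    -- (i) exact special fibre
    (𝓢 ⊔ K).comap jG = vanishingIdeal (⟨closure Z, isClosed_closure⟩ : Closeds G) ∧
    -- (ii) flat over `O`
    Flat ((𝓢 ⊔ K).subschemeι ≫ σ ≫ q) ∧
    -- (iii) the carrier is regular, both ideal sheaves are locally principal
    Scheme.IsRegular 𝓢.subscheme ∧ (∀ z : X, (stalkIdeal 𝓢 z).IsPrincipal ∧ (stalkIdeal K z).IsPrincipal) ∧
    -- (iv) off the generic point of `Y`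
    σ '' ((𝓢 ⊔ K).support : Set X) ⊆ {y : P | ¬ IsGenericPoint y Y} ∧
    -- (v) regular quotient stalks at the special points, off the excluded ones — of codimension `2` at the closed ones
    (∀ z ∈ ((𝓢 ⊔ K).support : Set X), (σ ≫ q) z = closedPoint O → z ∉ jG '' excl →
      IsRegularLocalRing (X.presheaf.stalk z ⧸ stalkIdeal (𝓢 ⊔ K) z) ∧
      (IsClosed ({z} : Set X) →
        ringKrullDim (X.presheaf.stalk z ⧸ stalkIdeal (𝓢 ⊔ K) z) + 2 = ringKrullDim (X.presheaf.stalk z))) ∧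
    -- (vi) centred packages at the excluded points
    (∀ y₀ ∈ excl, CentredPackage O P q X σ 𝓢 K (jG y₀)) ∧
    -- (vii-loc) the cone's special fibre is the downstairs shadow NEAR THE CARRIER CURVE (on an open neighbourhood of `Z`)
    (∃ V : G.Opens, Z ⊆ (V : Set G) ∧
      (K.comap jG).comap V.ι = (vanishingIdeal (⟨closure Kd, isClosed_closure⟩ : Closeds G)).comap V.ι) ∧
    -- (viii) the carrier cuts an effective Cartier divisor on the cone
    IsEffectiveCartier (𝓢.comap K.subschemeι) ∧
    -- (ix) THE PLANE TRACE: the carrier's special fibre is the reduced downstairs plane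
    𝓢.comap jG = vanishingIdeal (⟨closure Sd, isClosed_closure⟩ : Closeds G) ∧
    -- (x) the plane's model is flat over `O` ON ITS OWN (the seeded member's `FE` datum; res-L1-w45b-stub-4 SHAPE WORD 2026-08-28T08:22:44Z)
    Flat (𝓢.subschemeι ≫ σ ≫ q)

/-- `MemberS` is `∃ stage, MemberSAt` — by `rfl`. [OURS · pure logic] -/
theorem memberS_iff {G : Scheme.{0}} {T Z Kd Sd excl : Set G} :
    MemberS O k θ P q Y Ch G T Z Kd Sd excl ↔
      ∃ (X : Scheme.{0}) (σ : X ⟶ P) (S : Set X) (jG : G ⟶ X) (tG : G ⟶ Spec (.of k)) (𝓢 K : X.IdealSheafData),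
        MemberSAt O k θ P q Y Ch G T Z Kd Sd excl X σ S jG tG 𝓢 K :=
  Iff.rfl

/-- **`TCPlus.LetterDatum X σ jG L` — a MODEL-CARRYING LETTER at an explicit stage**: an ideal sheaf `𝓛` on `X` with (l-i) reduced trace
`𝓛.comap jG = 𝓘⟨closure L⟩`, (l-ii) stalkwise principal, (l-iii) `V(𝓛)` regular, (l-iv) `σ '' supp 𝓛` off the generic point of `Y`, (l-v) `V(𝓛) → Spec O`
flat (= `Tower.Exc₄`'s (e-i)–(e-iv) + `FE`, shadow forgotten). [OURS · L1 W4.5b · T23-A‴ (U6)] -/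
def LetterDatum (G : Scheme.{0}) (X : Scheme.{0}) (σ : X ⟶ P) (jG : G ⟶ X) (L : Set G) : Prop :=
  ∃ 𝓛 : X.IdealSheafData,
    𝓛.comap jG = vanishingIdeal (⟨closure L, isClosed_closure⟩ : Closeds G) ∧
    (∀ z : X, (stalkIdeal 𝓛 z).IsPrincipal) ∧ Scheme.IsRegular 𝓛.subscheme ∧
    σ '' (𝓛.support : Set X) ⊆ {y : P | ¬ IsGenericPoint y Y} ∧
    Flat (𝓛.subschemeι ≫ σ ≫ q)

/-- **`TCPlus.MemberSL` — a `MemberS` carrying a LIST `Ls` of model-carrying letters IN THE SAME STAGE.** [OURS · L1 W4.5b · T23-A‴ (U6)] -/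
def MemberSL (G : Scheme.{0}) (T Z Kd Sd : Set G) (Ls : List (Set G)) (excl : Set G) : Prop :=
  ∃ (X : Scheme.{0}) (σ : X ⟶ P) (S : Set X) (jG : G ⟶ X) (tG : G ⟶ Spec (.of k)) (𝓢 K : X.IdealSheafData),
    MemberSAt O k θ P q Y Ch G T Z Kd Sd excl X σ S jG tG 𝓢 K ∧ ∀ L ∈ Ls, LetterDatum O P q Y G X σ jG L

/-- **`TCPlus.InvSL` — `InvS` with the letter list threaded** (`INV W G β T Z K_d S_d Ls b`). [OURS · L1 W4.5b · T23-A‴ (U6)] -/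
def InvSL {F₁ F₂ : Scheme.{0}} (_W : Set F₁) (G : Scheme.{0}) (_β : G ⟶ F₂) (T Z Kd Sd : Set G) (Ls : List (Set G)) (b : Bool) : Prop :=
  IsIntegral G ∧ IsClosed T ∧ IsIrreducible T ∧ ¬ T ⊆ closure Z ∧ MemberSL O k θ P q Y Ch G T Z Kd Sd Ls ∅ ∧
    (b = false → ∀ y : ↥(vanishingIdeal (⟨closure Z, isClosed_closure⟩ : Closeds G)).subscheme,
      IsClosed ({((vanishingIdeal (⟨closure Z, isClosed_closure⟩ : Closeds G)).subschemeι y : G)} : Set G) →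
      ¬ IsRegularLocalRing ((vanishingIdeal (⟨closure Z, isClosed_closure⟩ : Closeds G)).subscheme.presheaf.stalk y) →
      MemberSL O k θ P q Y Ch G T Z Kd Sd Ls {((vanishingIdeal (⟨closure Z, isClosed_closure⟩ : Closeds G)).subschemeι y : G)})

/-! ## Pure-logic projections -/

/-- `MemberSL ⇒ MemberS` (forget the letters). [OURS · pure logic] -/
theorem memberSL_memberS {G : Scheme.{0}} {T Z Kd Sd excl : Set G} {Ls : List (Set G)} (h : MemberSL O k θ P q Y Ch G T Z Kd Sd Ls excl) :
    MemberS O k θ P q Y Ch G T Z Kd Sd excl := by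
  obtain ⟨X, σ, S, jG, tG, 𝓢, K, hAt, -⟩ := h
  exact ⟨X, σ, S, jG, tG, 𝓢, K, hAt⟩

/-- `MemberS ⇒ MemberSL` with the EMPTY letter list. [OURS · pure logic] -/
theorem memberSL_nil_of_memberS {G : Scheme.{0}} {T Z Kd Sd excl : Set G} (h : MemberS O k θ P q Y Ch G T Z Kd Sd excl) :
    MemberSL O k θ P q Y Ch G T Z Kd Sd [] excl := by
  obtain ⟨X, σ, S, jG, tG, 𝓢, K, hAt⟩ := h
  exact ⟨X, σ, S, jG, tG, 𝓢, K, hAt, fun L hL => by simp at hL⟩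

/-- Dropping letters. [OURS · pure logic] -/
theorem memberSL_of_sublist {G : Scheme.{0}} {T Z Kd Sd excl : Set G} {Ls Ls' : List (Set G)} (h : MemberSL O k θ P q Y Ch G T Z Kd Sd Ls excl)
    (hsub : ∀ L ∈ Ls', L ∈ Ls) : MemberSL O k θ P q Y Ch G T Z Kd Sd Ls' excl := by
  obtain ⟨X, σ, S, jG, tG, 𝓢, K, hAt, hL⟩ := h
  exact ⟨X, σ, S, jG, tG, 𝓢, K, hAt, fun L hL' => hL L (hsub L hL')⟩

/-- The letters' data, for the record: every letter has a model with reduced trace in SOME realisation of the member. [OURS · pure logic] -/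
theorem memberSL_letters {G : Scheme.{0}} {T Z Kd Sd excl : Set G} {Ls : List (Set G)} (h : MemberSL O k θ P q Y Ch G T Z Kd Sd Ls excl) :
    ∃ (X : Scheme.{0}) (σ : X ⟶ P) (jG : G ⟶ X) (tG : G ⟶ Spec (.of k)),
      IsPullback jG tG (σ ≫ q) (Spec.map (CommRingCat.ofHom θ)) ∧ ∀ L ∈ Ls, LetterDatum O P q Y G X σ jG L := by
  obtain ⟨X, σ, S, jG, tG, 𝓢, K, ⟨-, -, -, -, -, hsq, -⟩, hL⟩ := h
  exact ⟨X, σ, jG, tG, hsq, hL⟩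

/-- `InvSL ⇒ InvS`. [OURS · pure logic] -/
theorem invSL_invS {F₁ F₂ : Scheme.{0}} {W : Set F₁} {G : Scheme.{0}} {β : G ⟶ F₂} {T Z Kd Sd : Set G} {Ls : List (Set G)} {b : Bool}
    (h : InvSL O k θ P q Y Ch W G β T Z Kd Sd Ls b) : InvS O k θ P q Y Ch W G β T Z Kd Sd b := by
  obtain ⟨hG, hT, hTirr, hTZ, hmem, hcen⟩ := h
  exact ⟨hG, hT, hTirr, hTZ, memberSL_memberS O k θ P q Y Ch hmem, fun hb y hy hreg => memberSL_memberS O k θ P q Y Ch (hcen hb y hy hreg)⟩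

/-- `InvS ⇒ InvSL` with the empty letter list. [OURS · pure logic] -/
theorem invSL_nil_of_invS {F₁ F₂ : Scheme.{0}} {W : Set F₁} {G : Scheme.{0}} {β : G ⟶ F₂} {T Z Kd Sd : Set G} {b : Bool}
    (h : InvS O k θ P q Y Ch W G β T Z Kd Sd b) : InvSL O k θ P q Y Ch W G β T Z Kd Sd [] b := by
  obtain ⟨hG, hT, hTirr, hTZ, hmem, hcen⟩ := h
  exact ⟨hG, hT, hTirr, hTZ, memberSL_nil_of_memberS O k θ P q Y Ch hmem,
    fun hb y hy hreg => memberSL_nil_of_memberS O k θ P q Y Ch (hcen hb y hy hreg)⟩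

/-- Dropping letters in `InvSL`. [OURS · pure logic] -/
theorem invSL_of_sublist {F₁ F₂ : Scheme.{0}} {W : Set F₁} {G : Scheme.{0}} {β : G ⟶ F₂} {T Z Kd Sd : Set G} {Ls Ls' : List (Set G)}
    {b : Bool} (h : InvSL O k θ P q Y Ch W G β T Z Kd Sd Ls b) (hsub : ∀ L ∈ Ls', L ∈ Ls) :
    InvSL O k θ P q Y Ch W G β T Z Kd Sd Ls' b := by
  obtain ⟨hG, hT, hTirr, hTZ, hmem, hcen⟩ := h
  exact ⟨hG, hT, hTirr, hTZ, memberSL_of_sublist O k θ P q Y Ch hmem hsub,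
    fun hb y hy hreg => memberSL_of_sublist O k θ P q Y Ch (hcen hb y hy hreg) hsub⟩

/-- The uncentred member with letters, read off `InvSL`. [OURS · pure logic] -/
theorem invSL_memberSL {F₁ F₂ : Scheme.{0}} {W : Set F₁} {G : Scheme.{0}} {β : G ⟶ F₂} {T Z Kd Sd : Set G} {Ls : List (Set G)} {b : Bool}
    (h : InvSL O k θ P q Y Ch W G β T Z Kd Sd Ls b) : MemberSL O k θ P q Y Ch G T Z Kd Sd Ls ∅ :=
  h.2.2.2.2.1

end Summit.ResolutionOfSingularities.ResolutionOfSingularities.Cruxes.EquisingularLiftNat.Sections.TCPlus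

end
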